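import Literature.LinearAlgebra.Matrix.ProjectiveSpecialLinearGroupSimple
import HarnessLib

/-!
# `SL(V)` is perfect over an infinite field — basis-free, and for finite products (Artin, *Geometric Algebra*, IV Thm 4.7)

Layer `Literature/LinearAlgebra/Matrix`, namespace `Literature.LinearAlgebra.Matrix`. THEOREMS only (no definition,
no named fact): the tree's `SLn.commutator_eq_top` ("`SL_n(F)` is its own commutator group for `n ≥ 3`, or `n ≥ 2`
and `F ∌ {F₂, F₃}`", Artin IV, proof of Thm 4.7, p0134) transported from `Matrix.SpecialLinearGroup (Fin n) K` to the
automorphism group `V ≃ₗ[K] V` of a finite-dimensional space over an INFINITE field `K` (so that some `a ≠ 0` has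
`a² ≠ 1`, `exists_ne_zero_and_sq_ne_one_of_infinite`), with `SL(V)` rendered as the kernel of Mathlib's
`LinearEquiv.det : (V ≃ₗ[K] V) →* Kˣ`; and the same for a finite product `Π i, (E i ≃ₗ[K] E i)` (a product of
perfect groups is perfect).  Consumer forms: a subgroup containing all commutators of determinant-one automorphisms
contains every determinant-one automorphism (`mem_of_det_eq_one_of_forall_commutator_mem`,
`pi_mem_of_det_eq_one_of_forall_commutator_mem`).  Written by the prover seat `hodge-nonav-prover-Ax` (cell
`hodge-nonav`) for crux K1 `VeryGeneralDeckCommutatorsInHg` of `Summits/HodgeConjecture/HodgeConjecture/Theses/CyclicUnitaryPowers.lean`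
(`stmt-HodgeConjecture-19544`): `⊕ SL(E_i)(ℂ) ⊆ (Γ'^Zar)°` upgrades to `⊕ SL(E_i)(ℂ) ⊆ (⁅Γ', Γ'⁆)^Zar` because
`SL(E_i)(ℂ)` is perfect and commutators of closure points lie in the closure of the commutator group.

## References
* [Artin1988] E. Artin, *Geometric Algebra*, Wiley Classics Library (1988), Chap. IV, Thm 4.7 and its proof (p0134):
  every transvection is a commutator when `n ≥ 3` or `k ∌ {F₂, F₃}`; hence `SL_n(k)` is perfect.
-/

noncomputable section

open Matrix Matrix.SpecialLinearGroup
open scoped MatrixGroups commutatorElement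

namespace Literature.LinearAlgebra.Matrix

universe u v w

variable {K : Type u} [Field K] {V : Type v} [AddCommGroup V] [Module K V] [FiniteDimensional K V]

/-! ### One space -/

/-- In dimension `≤ 1` the only determinant-one automorphism is the identity. [folklore] -/
private theorem linearEquiv_eq_one_of_det_eq_one_of_finrank_le_one (h1 : Module.finrank K V ≤ 1) {u : V ≃ₗ[K] V}
    (hu : LinearEquiv.det u = 1) : u = 1 := by
  classical
  let b := Module.finBasis K V
  haveI : Subsingleton (Fin (Module.finrank K V)) := Fin.subsingleton_iff_le_one.mpr h1
  apply LinearEquiv.toLinearMap_injective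
  apply (LinearMap.toMatrix b b).injective
  have hdet : (LinearMap.toMatrix b b (u : V →ₗ[K] V)).det = 1 := by
    rw [LinearMap.det_toMatrix b, ← LinearEquiv.coe_det, hu, Units.val_one]
  rw [LinearEquiv.coe_toLinearMap_one, LinearMap.toMatrix_id]
  ext i j
  rw [Subsingleton.elim j i, Matrix.one_apply_eq, ← hdet, Matrix.det_eq_elem_of_subsingleton _ i]

/-- **`SL(V)` is perfect** (`V` finite-dimensional over an infinite field `K`): every automorphism of determinant
`1` lies in the commutator subgroup `⁅SL(V), SL(V)⁆` of `SL(V) = ker (LinearEquiv.det)`.  Transport of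
`SLn.commutator_eq_top` along the matrix of `u` in a basis (`Matrix.toLinearEquiv`, a group homomorphism
`SL(n, K) → GL(V)` with determinant-one values). [cite: Artin1988, Chap. IV Thm 4.7 (proof, p0134)] -/
theorem mem_commutator_ker_det_of_det_eq_one [Infinite K] {u : V ≃ₗ[K] V} (hu : LinearEquiv.det u = 1) :
    u ∈ ⁅(LinearEquiv.det : (V ≃ₗ[K] V) →* Kˣ).ker, (LinearEquiv.det : (V ≃ₗ[K] V) →* Kˣ).ker⁆ := by
  classical
  set n := Module.finrank K V with hn
  let b : Module.Basis (Fin n) K V := Module.finBasis K V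
  by_cases h1 : n ≤ 1
  · rw [linearEquiv_eq_one_of_det_eq_one_of_finrank_le_one h1 hu]
    exact one_mem _
  haveI : Nontrivial (Fin n) := Fin.nontrivial_iff_two_le.mpr (by omega)
  have hM : ∀ M : SpecialLinearGroup (Fin n) K, IsUnit (M : Matrix (Fin n) (Fin n) K).det := fun M => by
    rw [M.prop]; exact isUnit_one
  -- the comparison homomorphism `SL(n, K) → GL(V)` in the basis `b`
  let φ : SpecialLinearGroup (Fin n) K →* (V ≃ₗ[K] V) :=
    { toFun := fun M => Matrix.toLinearEquiv b (M : Matrix (Fin n) (Fin n) K) (hM M)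
      map_one' := by
        refine LinearEquiv.ext fun x => ?_
        rw [Matrix.toLinearEquiv_apply, Matrix.SpecialLinearGroup.coe_one, Matrix.toLin_one]
        rfl
      map_mul' := fun M N => by
        refine LinearEquiv.ext fun x => ?_
        rw [LinearEquiv.mul_apply, Matrix.toLinearEquiv_apply, Matrix.toLinearEquiv_apply,
          Matrix.toLinearEquiv_apply, Matrix.SpecialLinearGroup.coe_mul, Matrix.toLin_mul b b b,
          LinearMap.comp_apply] }
  have hφcoe : ∀ M : SpecialLinearGroup (Fin n) K, ((φ M : V ≃ₗ[K] V) : V →ₗ[K] V) =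
      Matrix.toLin b b (M : Matrix (Fin n) (Fin n) K) :=
    fun M => LinearMap.ext fun x => Matrix.toLinearEquiv_apply b _ (hM M) x
  have hφdet : ∀ M : SpecialLinearGroup (Fin n) K, LinearEquiv.det (φ M) = 1 := by
    intro M
    rw [← Units.val_eq_one, LinearEquiv.coe_det, hφcoe, LinearMap.det_toLin, M.prop]
  have hφle : (⊤ : Subgroup (SpecialLinearGroup (Fin n) K)).map φ ≤ (LinearEquiv.det : (V ≃ₗ[K] V) →* Kˣ).ker := by
    rintro _ ⟨M, -, rfl⟩
    exact (MonoidHom.mem_ker).2 (hφdet M)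
  -- the matrix of `u` is special linear, and `φ` of it is `u`
  have hudet : (LinearMap.toMatrix b b (u : V →ₗ[K] V)).det = 1 := by
    rw [LinearMap.det_toMatrix b, ← LinearEquiv.coe_det, hu, Units.val_one]
  let M₀ : SpecialLinearGroup (Fin n) K := ⟨LinearMap.toMatrix b b (u : V →ₗ[K] V), hudet⟩
  have huφ : u = φ M₀ := by
    refine LinearEquiv.ext fun x => ?_
    change u x = Matrix.toLinearEquiv b (LinearMap.toMatrix b b (u : V →ₗ[K] V)) (hM M₀) x
    rw [Matrix.toLinearEquiv_apply, Matrix.toLin_toMatrix]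
    rfl
  have hmem : M₀ ∈ commutator (SpecialLinearGroup (Fin n) K) := by
    rw [SLn.commutator_eq_top (Or.inr exists_ne_zero_and_sq_ne_one_of_infinite)]
    exact Subgroup.mem_top M₀
  have hmap := Subgroup.mem_map_of_mem φ hmem
  rw [commutator_def, Subgroup.map_commutator] at hmap
  rw [huφ]
  exact Subgroup.commutator_mono hφle hφle hmap

/-- Consumer form: **a subgroup of `GL(V)` containing the commutator of any two determinant-one automorphisms
contains every determinant-one automorphism** (`V` finite-dimensional over an infinite field).
[cite: Artin1988, Chap. IV Thm 4.7 (proof, p0134)] -/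
theorem mem_of_det_eq_one_of_forall_commutator_mem [Infinite K] (H : Subgroup (V ≃ₗ[K] V))
    (hH : ∀ v w : V ≃ₗ[K] V, LinearEquiv.det v = 1 → LinearEquiv.det w = 1 → v * w * v⁻¹ * w⁻¹ ∈ H)
    {u : V ≃ₗ[K] V} (hu : LinearEquiv.det u = 1) : u ∈ H := by
  have hle : ⁅(LinearEquiv.det : (V ≃ₗ[K] V) →* Kˣ).ker, (LinearEquiv.det : (V ≃ₗ[K] V) →* Kˣ).ker⁆ ≤ H := by
    rw [Subgroup.commutator_le]
    intro v hv w hw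
    rw [commutatorElement_def]
    exact hH v w ((MonoidHom.mem_ker).1 hv) ((MonoidHom.mem_ker).1 hw)
  exact hle (mem_commutator_ker_det_of_det_eq_one hu)

/-! ### Finite products -/

section Pi

variable {J : Type w} [Finite J] [DecidableEq J] {E : J → Type v} [∀ i, AddCommGroup (E i)]
  [∀ i, Module K (E i)] [∀ i, FiniteDimensional K (E i)]

/-- **`Π_i SL(E_i)` is perfect** (finitely many finite-dimensional spaces over an infinite field): a tuple of
determinant-one automorphisms lies in the commutator subgroup of `Π_i SL(E_i) = Subgroup.pi univ (ker det)` — each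
coordinate does (`mem_commutator_ker_det_of_det_eq_one`), pushed forward along `Pi.mulSingle i`, and a tuple is the
product of its coordinate singles (`Subgroup.pi_mem_of_mulSingle_mem`). [cite: Artin1988, Chap. IV Thm 4.7 (proof, p0134)] -/
theorem pi_mem_commutator_ker_det_of_det_eq_one [Infinite K] {u : Π i, (E i ≃ₗ[K] E i)}
    (hu : ∀ i, LinearEquiv.det (u i) = 1) :
    u ∈ ⁅Subgroup.pi Set.univ (fun i => (LinearEquiv.det : (E i ≃ₗ[K] E i) →* Kˣ).ker),
      Subgroup.pi Set.univ (fun i => (LinearEquiv.det : (E i ≃ₗ[K] E i) →* Kˣ).ker)⁆ := by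
  refine Subgroup.pi_mem_of_mulSingle_mem u fun i => ?_
  have hi := mem_commutator_ker_det_of_det_eq_one (hu i)
  have hmap := Subgroup.mem_map_of_mem (MonoidHom.mulSingle (fun j => E j ≃ₗ[K] E j) i) hi
  rw [Subgroup.map_commutator] at hmap
  have hle : ((LinearEquiv.det : (E i ≃ₗ[K] E i) →* Kˣ).ker).map (MonoidHom.mulSingle (fun j => E j ≃ₗ[K] E j) i) ≤
      Subgroup.pi Set.univ (fun j => (LinearEquiv.det : (E j ≃ₗ[K] E j) →* Kˣ).ker) := by
    rintro _ ⟨x, hx, rfl⟩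
    rw [MonoidHom.mulSingle_apply, Subgroup.mulSingle_mem_pi]
    exact fun _ => hx
  exact Subgroup.commutator_mono hle hle hmap

/-- Consumer form for products: **a subgroup of `Π_i GL(E_i)` containing the commutator of any two tuples of
determinant-one automorphisms contains every such tuple** (finitely many finite-dimensional spaces over an infinite
field). [cite: Artin1988, Chap. IV Thm 4.7 (proof, p0134)] -/
theorem pi_mem_of_det_eq_one_of_forall_commutator_mem [Infinite K] (H : Subgroup (Π i, (E i ≃ₗ[K] E i)))
    (hH : ∀ v w : Π i, (E i ≃ₗ[K] E i), (∀ i, LinearEquiv.det (v i) = 1) → (∀ i, LinearEquiv.det (w i) = 1) →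
      v * w * v⁻¹ * w⁻¹ ∈ H)
    {u : Π i, (E i ≃ₗ[K] E i)} (hu : ∀ i, LinearEquiv.det (u i) = 1) : u ∈ H := by
  have hle : ⁅Subgroup.pi Set.univ (fun i => (LinearEquiv.det : (E i ≃ₗ[K] E i) →* Kˣ).ker),
      Subgroup.pi Set.univ (fun i => (LinearEquiv.det : (E i ≃ₗ[K] E i) →* Kˣ).ker)⁆ ≤ H := by
    rw [Subgroup.commutator_le]
    intro v hv w hw
    rw [commutatorElement_def]
    refine hH v w (fun i => ?_) (fun i => ?_)
    · exact (MonoidHom.mem_ker).1 ((Subgroup.mem_pi _).1 hv i (Set.mem_univ i))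
    · exact (MonoidHom.mem_ker).1 ((Subgroup.mem_pi _).1 hw i (Set.mem_univ i))
  exact hle (pi_mem_commutator_ker_det_of_det_eq_one hu)

end Pi

end Literature.LinearAlgebra.Matrix

end
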